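import Literature.MathematicalPhysics.QuantumFieldTheory.Balaban1983to89.B9Thm311FlatCoercivityAllLettersZdPer

/-!
# `Balaban1983to89.B9Thm311FlatPropagatorBoundZdPer` — [Balaban1985BackgroundPropagators] THEOREM 3.11 ∕ (3.27) p. 395 AT THE FLAT BACKGROUND ON THE
# TORUS `T_P` READ ON `ℤᵈ`, WITH AN EXPLICIT CONSTANT: THE PERIODIC PROPAGATOR `G_𝔤^per(1) = (Δ_a(1)↾E_𝔤^per(P))⁻¹` OF THE GENUINE FOUR-LETTER RECORD
# `opsAllZdPer` IS BOUNDED IN `L²_τ(T_P)` BY `γ⁻¹`, `γ = (1∕((d+1)·Cst d 1))·min(η·w_k·L^{2k}∕Lᵏᵈ, 1)` the flat coercivity constant of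
# `B9Thm311FlatCoercivityAllLettersZdPer`: `Σ_μΣ_{[0,P)ᵈ} Re τ|G(1)J|² ≤ γ⁻²·Σ_μΣ_{[0,P)ᵈ} Re τ|J|²` for every periodic Hermitian `J`, and `G(1)` is a
# POSITIVE operator with `γ·‖G(1)J‖²_τ ≤ ⟨J, G(1)J⟩_per ≤ γ⁻¹·‖J‖²_τ`

statement-level skeleton of published theorems with citation tags; proofs where landed; nothing here is a claim about the
Yang–Mills mass gap

`[Balaban1985BackgroundPropagators]` ("B9", CMP **99** (1985) 389–434) Thm 3.11 p. 416 *«the operators Δ′_a, G′, (Q′G′²Q′*)⁻¹, Δ_a, G are positive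
definite»*, (3.26)–(3.27) p. 395 *«G(U) = (Δ_a↾Ω₀)⁻¹»*, (3.17) p. 393 (the scalar product); `[Balaban1984PropagatorsI]` ("B5") Prop. 1.1 (1.90) p. 33;
`[Balaban1985RegularSpaces]` ("B8") (1.58) p. 86, p. 77 *«Ω_j = T_η»*.  PDF held: `paper:balaban1985-cmp99-background-propagators` pp. 393–395, 416
(re-read 2026-08-28 through the tree docstrings of `B9Eq327GreenZdHermPer` ∕ `B9SupplySockB9P3ZdAllLettersZdPer`).

CITATION HEADER (lean-in-tree rule).  Cell `pub-ymgap` (YM Track A, HUMAN RULINGS D-0062 ∕ D-0149), node N06 = [B9], width seat `pub-ymgap-dag-n06-w3` (g6);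
capstone + 1 of this seat's bridge pub-balaban NE9 chain ⟶ (β′-PERIODIC) road (memo `HOME/pub-ymgap-dag-n06-w3/BRIDGE-NE9-PERIODIC-g6.md`).  WHY.
dag-n06-b's `B9Eq327GreenZdHermPer.gopZdHPer` is print's `G(U₀) = (Δ_a)⁻¹` on the periodic Hermitian carrier, TOTAL by a `dif` on the regime `RegularAtHPer`
and consumed through the binder `InvAtHIPer` (the identity `G Δ_a A = A`, no size).  At the flat background the regime holds (dag-n06-b g23
`B9Thm311FlatPositivityZdPer.regularAtHPer_opsAllZdPer_one`) and this seat's capstone gives `γ·‖A‖²_τ ≤ ⟨A, Δ_a(1)A⟩_per` with an explicit `γ`.  THIS FILE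
turns the two into the SIZE of the flat propagator: `‖G(1)‖_{L²_τ → L²_τ} ≤ γ⁻¹` — the flat anchor of the «positive definite … G» half of Theorem 3.11
with a number, which a (3.25) ∕ (3.84)-type perturbation `G(U) = G(1)(I − V G(1))⁻¹` (p. 416) starts from.

WHAT IS PROVED (kernel, 0 sorry, 0 def).
* §1 `re_trace_star_mul_le_young` (`Re τ(a*b) ≤ (t∕2)Re τ(a*a) + (1∕(2t))Re τ(b*b)`, `t > 0`, Hermitian faithful `τ`), ★ `bondPairPer_le_young`
  (`⟨A, J⟩_per ≤ (t∕2)Σ|A|²_τ + (1∕(2t))Σ|J|²_τ`).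
* §2 ★ `deltaAOf_gopZdHPer_of_mem` (in the regime `RegularAtHPer η o P U₀`: `Δ_a(U₀)(G_𝔤^per(U₀)J) = J` for `J ∈ E_𝔤^per(P)` — the other half of (3.27);
  dag-n06-b's `gopZdHPer_apply_eq_of_regularAtHPer` is `G Δ_a A = A`).
* §3 ★★★ `sum_box_sq_gop_one_le` (statement in the header: member `(M, i, k)`, `i.Ω j = ℤᵈ`, `i.Λs k = torusLam k`, `ΛbP k = torusLamb k`, `P = Lᵏ·n`,
  `η·Lᵏ ≤ 1`, `L ≥ 2`, faithful Hermitian tracial `τ`, `J ∈ domSubHPer P`).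
* §4 `bondPairPer_comm` (`⟨A, B⟩_per = ⟨B, A⟩_per`, Hermitian `τ`), ★★ `bondPairPer_gop_one_bounds` («G positive definite» with numbers:
  `γ·‖G(1)J‖²_τ ≤ ⟨J, G(1)J⟩_per ≤ γ⁻¹·‖J‖²_τ`, same hypotheses as §3).

HONEST SCOPE.  Count-neutral helper (`--supports` the K1 item of record).  Flat background `U₀ = 1` only, all-torus class only; the one estimate is N02's
kernel-certified [B5] (1.90) imported through the NE9 chain and this seat's bridge (explicit constant, no new estimate); `L²_τ(T_P)` operator bound only —
NO decay ((3.28)–(3.30)), no curved `U₀`, no (3.84) perturbation, no member-uniformity beyond the display; N05 ∕ N06 NOT discharged; K1 NOT closed; one finite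
`𝕋⁴` programme at fixed `ε`, Bałaban as printed; R4 closes only the conditional finite-`𝕋⁴` rung `BalabanLadder.UV` — nothing continuum ∕ ℝ⁴ ∕ OS ∕ mass
gap ∕ Clay.  Unit `pub-ymgap-dag-n06-w3` (g6), 2026-08-28; NEW file importing `B9Thm311FlatCoercivityAllLettersZdPer`; modifies nothing.  Net new unproved facts: 0.
-/

noncomputable section

open scoped BigOperators ComplexConjugate

namespace Literature.MathematicalPhysics.QuantumFieldTheory.Balaban1983to89.B9Thm311FlatPropagatorBoundZdPer

open B7Prop2Explicit (unitaryUnits)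
open B8LeafModelZd (ZdIdx)
open T4TermwiseTorus (IsPeriodic box)
open B9Eq316AveragingTransposeZd (wQ)
open B9SupplySockB9P3ZdLetters (OpsZd deltaAOf)
open B9SupplySockB9P3ZdGammaInAkDpZd (withDpZd)
open B9Eq316AveragingTransposeZdPrinted (QQZdP withQQP)
open B9Eq327GreenZdHermPer (domSubHPer mem_domSubHPer_iff bondPairPer RegularAtHPer gopZdHPer deltaAEquivHPer deltaAEquivHPer_coe
  gopZdHPer_of_regularAtHPer gopZdHPer_mem_domSubHPer restrictLinHPer restrictLinHPer_of_mem)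
open B9SupplySockB9P3ZdAllLettersZdPer (opsAllZdPer opsLandauPer opsAllZdPer_Gop deltaAOf_opsAllZdPer)
open B9Thm311FlatCoercivityAllLettersZdPer (bondPairPer_deltaAOf_opsAllZdPer_one_ge)

-- `Site` alone could resolve to the torus sites of `Setup.lean`; re-export the `ℤ^d` sites of `B7Prop1Explicit`.
export B7Prop1Explicit (Site)

variable {d : ℕ} {𝔸 : Type*} [CStarAlgebra 𝔸]

/-! ## §1  Young's inequality for the trace pairing on the period cell -/

section Young

variable (τ : 𝔸 →ₗ[ℂ] ℂ) (P : ℕ)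

/-- **YOUNG FOR THE TRACE PAIRING**: for a Hermitian (`τ(a*) = conj τ(a)`) positive (`Re τ(a*a) ≥ 0`) functional and `t > 0`,
`Re τ(a*b) ≤ (t∕2)·Re τ(a*a) + (1∕(2t))·Re τ(b*b)` — from `0 ≤ Re τ((t•a − b)*(t•a − b))`. [cite: Balaban1985BackgroundPropagators, (3.17) p.393 (bookkeeping: the scalar product)] -/
theorem re_trace_star_mul_le_young (hτs : ∀ a : 𝔸, τ (star a) = starRingEnd ℂ (τ a)) (hτp : ∀ a : 𝔸, a ≠ 0 → 0 < (τ (star a * a)).re)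
    (a b : 𝔸) {t : ℝ} (ht : 0 < t) :
    (τ (star a * b)).re ≤ t / 2 * (τ (star a * a)).re + 1 / (2 * t) * (τ (star b * b)).re := by
  have hnn : ∀ c : 𝔸, 0 ≤ (τ (star c * c)).re := fun c => by
    by_cases hc : c = 0
    · rw [hc, mul_zero, map_zero, Complex.zero_re]
    · exact (hτp c hc).le
  have hsym : (τ (star b * a)).re = (τ (star a * b)).re := by
    rw [show star b * a = star (star a * b) by rw [star_mul, star_star], hτs, Complex.conj_re]
  have h0 := hnn ((t : ℂ) • a - b)
  have hexp : (τ (star (((t : ℂ)) • a - b) * (((t : ℂ)) • a - b))).re =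
      t ^ 2 * (τ (star a * a)).re - 2 * t * (τ (star a * b)).re + (τ (star b * b)).re := by
    rw [star_sub, star_smul, Complex.star_def, Complex.conj_ofReal, sub_mul, mul_sub, mul_sub, smul_mul_smul_comm, smul_mul_assoc,
      mul_smul_comm, map_sub, map_sub, map_sub, map_smul, map_smul, map_smul, Complex.sub_re, Complex.sub_re, Complex.sub_re,
      smul_eq_mul, smul_eq_mul, smul_eq_mul, ← Complex.ofReal_mul, Complex.re_ofReal_mul, Complex.re_ofReal_mul, Complex.re_ofReal_mul, hsym]
    ring
  rw [hexp] at h0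
  have key : 2 * t * (τ (star a * b)).re ≤ t ^ 2 * (τ (star a * a)).re + (τ (star b * b)).re := by linarith
  have h2t : (0 : ℝ) < 2 * t := by positivity
  calc (τ (star a * b)).re = 2 * t * (τ (star a * b)).re / (2 * t) := by field_simp
    _ ≤ (t ^ 2 * (τ (star a * a)).re + (τ (star b * b)).re) / (2 * t) := div_le_div_of_nonneg_right key h2t.le
    _ = t / 2 * (τ (star a * a)).re + 1 / (2 * t) * (τ (star b * b)).re := by field_simp

/-- ★ **YOUNG FOR THE BOND PAIRING ON THE CELL**: `⟨A, J⟩_per ≤ (t∕2)·Σ|A|²_τ + (1∕(2t))·Σ|J|²_τ`. [cite: Balaban1985BackgroundPropagators, (3.17) p.393, (3.27) p.395 (bookkeeping)] -/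
theorem bondPairPer_le_young (hτs : ∀ a : 𝔸, τ (star a) = starRingEnd ℂ (τ a)) (hτp : ∀ a : 𝔸, a ≠ 0 → 0 < (τ (star a * a)).re)
    (A J : Site d → Fin d → 𝔸) {t : ℝ} (ht : 0 < t) :
    bondPairPer τ P A J ≤ t / 2 * (∑ μ : Fin d, ∑ x ∈ box (d := d) P, (τ (star (A x μ) * A x μ)).re) +
      1 / (2 * t) * (∑ μ : Fin d, ∑ x ∈ box (d := d) P, (τ (star (J x μ) * J x μ)).re) := by
  rw [bondPairPer, Finset.mul_sum, Finset.mul_sum, ← Finset.sum_add_distrib]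
  refine Finset.sum_le_sum fun μ _ => ?_
  rw [Finset.mul_sum, Finset.mul_sum, ← Finset.sum_add_distrib]
  exact Finset.sum_le_sum fun x _ => re_trace_star_mul_le_young τ hτs hτp (A x μ) (J x μ) ht

end Young

/-! ## §2  In the regime `RegularAtHPer`, `Δ_a(U₀)(G_𝔤^per(U₀) J) = J` for `J ∈ E_𝔤^per(P)` -/

section Regime

variable {η : ℝ} {o : OpsZd d 𝔸} (P : ℕ) [NeZero P] {U₀ : Site d → Fin d → 𝔸ˣ}

/-- ★ **`Δ_a(U₀) G_𝔤^per(U₀) J = J` ON THE CARRIER** in the regime: the other half of (3.27) (dag-n06-b's `gopZdHPer_apply_eq_of_regularAtHPer` is `G Δ_a A = A`).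
[cite: Balaban1985BackgroundPropagators, (3.27) p.395; Balaban1985RegularSpaces, (1.58) p.86, p.77] -/
theorem deltaAOf_gopZdHPer_of_mem (h : RegularAtHPer η o P U₀) {J : Site d → Fin d → 𝔸} (hJ : J ∈ domSubHPer (d := d) (𝔸 := 𝔸) P) :
    deltaAOf η o U₀ (gopZdHPer η o P U₀ J) = J := by
  rw [gopZdHPer_of_regularAtHPer η o P U₀ h, ← deltaAEquivHPer_coe η o P U₀ h, LinearEquiv.apply_symm_apply,
    restrictLinHPer_of_mem P ⟨J, hJ⟩]

end Regime

/-! ## §3  The flat periodic propagator of the genuine torus record is bounded by `γ⁻¹` in `L²_τ(T_P)` -/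

section Bound

variable (τ : 𝔸 →ₗ[ℂ] ℂ) {L : ℕ} [NeZero L] (k n : ℕ) [NeZero n] [Nontrivial 𝔸] [FiniteDimensional ℝ 𝔸]

/-- ★★★ **[B9] THM 3.11 ∕ (3.27) AT THE FLAT BACKGROUND ON THE TORUS, WITH AN EXPLICIT CONSTANT: `‖G_𝔤^per(1) J‖_{L²_τ(T_P)} ≤ γ⁻¹·‖J‖_{L²_τ(T_P)}`**
for the GENUINE four-letter torus record `opsAllZdPer` at a member `(M, i, k)` with the all-torus classes (`i.Ω j = ℤᵈ`, `i.Λs k = torusLam k`,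
`ΛbP k = torusLamb k`), `P = Lᵏ·n`, `η·Lᵏ ≤ 1`, `L ≥ 2`, a faithful Hermitian tracial `τ`, and every periodic Hermitian `J ∈ E_𝔤^per(P)`:
`Σ_μΣ_{[0,P)ᵈ} Re τ|(G(1)J)|² ≤ γ⁻²·Σ_μΣ_{[0,P)ᵈ} Re τ|J|²`, `γ = (1∕((d+1)·Cst d 1))·min(η·w_k·L^{2k}∕Lᵏᵈ, 1)` — the explicit coercivity of
`B9Thm311FlatCoercivityAllLettersZdPer` + `Δ_a(1)G(1)J = J` (§2, dag-n06-b's `RegularAtHPer` at `1`) + Young (§1).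
[cite: Balaban1985BackgroundPropagators, Thm 3.11 p.416, (3.27) p.395, (3.26) p.395; Balaban1984PropagatorsI, Prop. 1.1 (1.90) p.33; Balaban1985RegularSpaces, (1.58) p.86, p.77 («Ω_j = T_η»)] -/
theorem sum_box_sq_gop_one_le (hτs : ∀ b : 𝔸, τ (star b) = starRingEnd ℂ (τ b))
    (hτp : ∀ b : 𝔸, b ≠ 0 → 0 < (τ (star b * b)).re) (hτt : ∀ b b' : 𝔸, τ (b * b') = τ (b' * b)) (hL : 2 ≤ L)
    {ΛbP : ℕ → ℕ → Set (Site d × Fin d)} (hΛb : ΛbP k = B8Thm2TorusMember.torusLamb k) (ops₀ : ℝ → ZdIdx d L → ℕ → OpsZd d 𝔸) (M : ℝ)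
    (i : ZdIdx d L) (hηL : i.η * (L ^ k : ℕ) ≤ 1) (hΩ : ∀ j, i.Ω j = Set.univ) (hΛs : i.Λs k = B8Thm4TorusAt.torusLam k)
    {J : Site d → Fin d → 𝔸} (hJ : J ∈ domSubHPer (d := d) (𝔸 := 𝔸) (L ^ k * n)) :
    (∑ μ : Fin d, ∑ z ∈ box (d := d) (L ^ k * n),
        (τ (star ((opsAllZdPer τ L (L ^ k * n) ΛbP ops₀ M i k).Gop 1 J z μ) * (opsAllZdPer τ L (L ^ k * n) ΛbP ops₀ M i k).Gop 1 J z μ)).re) ≤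
      (((1 / ((d + 1 : ℝ) * B5Prop11Plancherel.Cst d 1)) * min (i.η * wQ (d := d) L i.η k * ((L : ℝ) ^ k) ^ 2 / (((L ^ k : ℕ) : ℝ) ^ d)) 1) ^ 2)⁻¹ *
        ∑ μ : Fin d, ∑ z ∈ box (d := d) (L ^ k * n), (τ (star (J z μ) * J z μ)).re := by
  -- names
  set γ : ℝ := (1 / ((d + 1 : ℝ) * B5Prop11Plancherel.Cst d 1)) *
    min (i.η * wQ (d := d) L i.η k * ((L : ℝ) ^ k) ^ 2 / (((L ^ k : ℕ) : ℝ) ^ d)) 1 with hγ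
  set G : Site d → Fin d → 𝔸 := (opsAllZdPer τ L (L ^ k * n) ΛbP ops₀ M i k).Gop 1 J with hG
  set SG : ℝ := ∑ μ : Fin d, ∑ z ∈ box (d := d) (L ^ k * n), (τ (star (G z μ) * G z μ)).re with hSG
  set SJ : ℝ := ∑ μ : Fin d, ∑ z ∈ box (d := d) (L ^ k * n), (τ (star (J z μ) * J z μ)).re with hSJ
  have hL1 : 1 ≤ L := le_trans (by norm_num) hL
  -- `γ > 0`
  have hC : (1 : ℝ) ≤ B5Prop11Plancherel.Cst d 1 := le_trans (le_max_right _ _) (le_max_right _ _)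
  have hγ0 : 0 < γ := by
    rw [hγ]
    refine mul_pos (div_pos one_pos (mul_pos (by positivity) (lt_of_lt_of_le one_pos hC))) (lt_min ?_ one_pos)
    exact div_pos (mul_pos (mul_pos i.hη (B9Thm311FlatHermKernelZd.wQ_pos hL1 i.hη k)) (by positivity)) (by positivity)
  -- the regime at `U₀ = 1` (dag-n06-b) and `G J ∈ E_𝔤^per`
  have hreg : RegularAtHPer i.η (opsLandauPer τ (L ^ k * n) (withDpZd (withQQP τ L ΛbP ops₀)) M i k) (L ^ k * n) (1 : Site d → Fin d → 𝔸ˣ) :=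
    B9Thm311FlatPositivityZdPer.regularAtHPer_opsAllZdPer_one τ (L ^ k * n) hτt hτs hτp hL ops₀ M i hΩ hΛs hΛb (dvd_mul_right _ _)
  have hGdef : G = gopZdHPer i.η (opsLandauPer τ (L ^ k * n) (withDpZd (withQQP τ L ΛbP ops₀)) M i k) (L ^ k * n) 1 J := by
    rw [hG, opsAllZdPer_Gop]
  have hGmem : G ∈ domSubHPer (d := d) (𝔸 := 𝔸) (L ^ k * n) := by rw [hGdef]; exact gopZdHPer_mem_domSubHPer _ _ _ _ J
  have hΔG : deltaAOf i.η (opsAllZdPer τ L (L ^ k * n) ΛbP ops₀ M i k) 1 G = J := by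
    rw [deltaAOf_opsAllZdPer, hGdef]
    exact deltaAOf_gopZdHPer_of_mem (L ^ k * n) hreg hJ
  -- coercivity at `G`, the identity `Δ_a G = J`, and Young with `t = γ`
  have hco := bondPairPer_deltaAOf_opsAllZdPer_one_ge τ k n hτs hτp hτt hL hΛb ops₀ M i hηL hΛs hGmem.1 hGmem.2
  rw [hΔG, ← hγ] at hco
  have hyo := bondPairPer_le_young τ (L ^ k * n) hτs hτp G J hγ0
  -- `γ·SG ≤ (γ/2)·SG + (1/(2γ))·SJ` ⟹ `SG ≤ γ⁻²·SJ`
  have h1 : γ * SG ≤ γ / 2 * SG + 1 / (2 * γ) * SJ := hco.trans hyo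
  have h2 : γ / 2 * SG ≤ 1 / (2 * γ) * SJ := by linarith
  have h3 : SG ≤ (γ ^ 2)⁻¹ * SJ := by
    have h4 : γ ^ 2 * SG ≤ SJ := by
      have := mul_le_mul_of_nonneg_left h2 (show (0 : ℝ) ≤ 2 * γ from by positivity)
      calc γ ^ 2 * SG = 2 * γ * (γ / 2 * SG) := by ring
        _ ≤ 2 * γ * (1 / (2 * γ) * SJ) := this
        _ = SJ := by field_simp
    calc SG = (γ ^ 2)⁻¹ * (γ ^ 2 * SG) := by rw [← mul_assoc, inv_mul_cancel₀ (pow_ne_zero 2 hγ0.ne'), one_mul]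
      _ ≤ (γ ^ 2)⁻¹ * SJ := mul_le_mul_of_nonneg_left h4 (inv_nonneg.mpr (sq_nonneg γ))
  exact h3

end Bound

/-! ## §4  «G is positive definite» (Thm 3.11) at the flat background, with numbers: `0 ≤ ⟨J, G(1)J⟩_per ≤ γ⁻¹·‖J‖²_τ` -/

section Form

variable (τ : 𝔸 →ₗ[ℂ] ℂ) (P : ℕ)

/-- the bond pairing is symmetric for a Hermitian `τ`: `⟨A, B⟩_per = ⟨B, A⟩_per`. [cite: Balaban1985BackgroundPropagators, p.391 (the scalar product is symmetric), (3.17) p.393] -/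
theorem bondPairPer_comm (hτs : ∀ a : 𝔸, τ (star a) = starRingEnd ℂ (τ a)) (A B : Site d → Fin d → 𝔸) :
    bondPairPer τ P A B = bondPairPer τ P B A := by
  refine Finset.sum_congr rfl fun μ _ => Finset.sum_congr rfl fun x _ => ?_
  rw [show star (A x μ) * B x μ = star (star (B x μ) * A x μ) by rw [star_mul, star_star], hτs, Complex.conj_re]

variable {L : ℕ} [NeZero L] (k n : ℕ) [NeZero n] [Nontrivial 𝔸] [FiniteDimensional ℝ 𝔸]

/-- ★★ **`G_𝔤^per(1)` IS A POSITIVE OPERATOR WITH AN EXPLICIT FORM BOUND** (Thm 3.11: «… Δ_a, G are positive definite», at `U = 1` on `T_P`): for every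
`J ∈ E_𝔤^per(P)` of the all-torus member, `γ·‖G(1)J‖²_τ ≤ ⟨J, G(1)J⟩_per ≤ γ⁻¹·‖J‖²_τ` (so `0 ≤ ⟨J, G(1)J⟩_per`), `γ` the flat constant of
`B9Thm311FlatCoercivityAllLettersZdPer`. [cite: Balaban1985BackgroundPropagators, Thm 3.11 p.416, (3.27) p.395; Balaban1984PropagatorsI, Prop. 1.1 (1.90) p.33; Balaban1985RegularSpaces, p.77 («Ω_j = T_η»)] -/
theorem bondPairPer_gop_one_bounds (hτs : ∀ b : 𝔸, τ (star b) = starRingEnd ℂ (τ b))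
    (hτp : ∀ b : 𝔸, b ≠ 0 → 0 < (τ (star b * b)).re) (hτt : ∀ b b' : 𝔸, τ (b * b') = τ (b' * b)) (hL : 2 ≤ L)
    {ΛbP : ℕ → ℕ → Set (Site d × Fin d)} (hΛb : ΛbP k = B8Thm2TorusMember.torusLamb k) (ops₀ : ℝ → ZdIdx d L → ℕ → OpsZd d 𝔸) (M : ℝ)
    (i : ZdIdx d L) (hηL : i.η * (L ^ k : ℕ) ≤ 1) (hΩ : ∀ j, i.Ω j = Set.univ) (hΛs : i.Λs k = B8Thm4TorusAt.torusLam k)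
    {J : Site d → Fin d → 𝔸} (hJ : J ∈ domSubHPer (d := d) (𝔸 := 𝔸) (L ^ k * n)) :
    (1 / ((d + 1 : ℝ) * B5Prop11Plancherel.Cst d 1)) * min (i.η * wQ (d := d) L i.η k * ((L : ℝ) ^ k) ^ 2 / (((L ^ k : ℕ) : ℝ) ^ d)) 1 *
        (∑ μ : Fin d, ∑ z ∈ box (d := d) (L ^ k * n),
          (τ (star ((opsAllZdPer τ L (L ^ k * n) ΛbP ops₀ M i k).Gop 1 J z μ) * (opsAllZdPer τ L (L ^ k * n) ΛbP ops₀ M i k).Gop 1 J z μ)).re) ≤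
      bondPairPer τ (L ^ k * n) J ((opsAllZdPer τ L (L ^ k * n) ΛbP ops₀ M i k).Gop 1 J) ∧
    bondPairPer τ (L ^ k * n) J ((opsAllZdPer τ L (L ^ k * n) ΛbP ops₀ M i k).Gop 1 J) ≤
      ((1 / ((d + 1 : ℝ) * B5Prop11Plancherel.Cst d 1)) * min (i.η * wQ (d := d) L i.η k * ((L : ℝ) ^ k) ^ 2 / (((L ^ k : ℕ) : ℝ) ^ d)) 1)⁻¹ *
        ∑ μ : Fin d, ∑ z ∈ box (d := d) (L ^ k * n), (τ (star (J z μ) * J z μ)).re := by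
  -- names (as in §3)
  set γ : ℝ := (1 / ((d + 1 : ℝ) * B5Prop11Plancherel.Cst d 1)) *
    min (i.η * wQ (d := d) L i.η k * ((L : ℝ) ^ k) ^ 2 / (((L ^ k : ℕ) : ℝ) ^ d)) 1 with hγ
  set G : Site d → Fin d → 𝔸 := (opsAllZdPer τ L (L ^ k * n) ΛbP ops₀ M i k).Gop 1 J with hG
  set SG : ℝ := ∑ μ : Fin d, ∑ z ∈ box (d := d) (L ^ k * n), (τ (star (G z μ) * G z μ)).re with hSG
  set SJ : ℝ := ∑ μ : Fin d, ∑ z ∈ box (d := d) (L ^ k * n), (τ (star (J z μ) * J z μ)).re with hSJ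
  have hL1 : 1 ≤ L := le_trans (by norm_num) hL
  have hC : (1 : ℝ) ≤ B5Prop11Plancherel.Cst d 1 := le_trans (le_max_right _ _) (le_max_right _ _)
  have hγ0 : 0 < γ := by
    rw [hγ]
    refine mul_pos (div_pos one_pos (mul_pos (by positivity) (lt_of_lt_of_le one_pos hC))) (lt_min ?_ one_pos)
    exact div_pos (mul_pos (mul_pos i.hη (B9Thm311FlatHermKernelZd.wQ_pos hL1 i.hη k)) (by positivity)) (by positivity)
  have hreg : RegularAtHPer i.η (opsLandauPer τ (L ^ k * n) (withDpZd (withQQP τ L ΛbP ops₀)) M i k) (L ^ k * n) (1 : Site d → Fin d → 𝔸ˣ) :=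
    B9Thm311FlatPositivityZdPer.regularAtHPer_opsAllZdPer_one τ (L ^ k * n) hτt hτs hτp hL ops₀ M i hΩ hΛs hΛb (dvd_mul_right _ _)
  have hGdef : G = gopZdHPer i.η (opsLandauPer τ (L ^ k * n) (withDpZd (withQQP τ L ΛbP ops₀)) M i k) (L ^ k * n) 1 J := by
    rw [hG, opsAllZdPer_Gop]
  have hGmem : G ∈ domSubHPer (d := d) (𝔸 := 𝔸) (L ^ k * n) := by rw [hGdef]; exact gopZdHPer_mem_domSubHPer _ _ _ _ J
  have hΔG : deltaAOf i.η (opsAllZdPer τ L (L ^ k * n) ΛbP ops₀ M i k) 1 G = J := by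
    rw [deltaAOf_opsAllZdPer, hGdef]
    exact deltaAOf_gopZdHPer_of_mem (L ^ k * n) hreg hJ
  -- lower bound: coercivity at `G` with `Δ_a G = J`, then symmetry
  have hco := bondPairPer_deltaAOf_opsAllZdPer_one_ge τ k n hτs hτp hτt hL hΛb ops₀ M i hηL hΛs hGmem.1 hGmem.2
  rw [hΔG, ← hγ, bondPairPer_comm τ (L ^ k * n) hτs G J] at hco
  refine ⟨hco, ?_⟩
  -- upper bound: Young with `t = γ` and §3
  have hyo := bondPairPer_le_young τ (L ^ k * n) hτs hτp G J hγ0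
  rw [bondPairPer_comm τ (L ^ k * n) hτs G J] at hyo
  have h3 : SG ≤ (γ ^ 2)⁻¹ * SJ := by
    have h := sum_box_sq_gop_one_le τ k n hτs hτp hτt hL hΛb ops₀ M i hηL hΩ hΛs hJ
    rw [← hγ] at h
    exact h
  calc bondPairPer τ (L ^ k * n) J G ≤ γ / 2 * SG + 1 / (2 * γ) * SJ := hyo
    _ ≤ γ / 2 * ((γ ^ 2)⁻¹ * SJ) + 1 / (2 * γ) * SJ := by
        have := mul_le_mul_of_nonneg_left h3 (show (0 : ℝ) ≤ γ / 2 by positivity); linarith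
    _ = γ⁻¹ * SJ := by field_simp; ring

end Form

end Literature.MathematicalPhysics.QuantumFieldTheory.Balaban1983to89.B9Thm311FlatPropagatorBoundZdPer

end
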